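import Mathlib.LinearAlgebra.Eigenspace.Pi
import Literature.NumberTheory.EllipticCurves.NewformsMainLemmaCarltonProofs
import Literature.NumberTheory.EllipticCurves.DeligneSerreProp27Proofs
import HarnessLib

/-!
# The eigenvalue packet of an eigenform on `Γ₁(M)` is the packet of a newform of level dividing `M`
# (Atkin–Lehner–Li; Diamond–Shurman Thm. 5.8.2–5.8.3 with Prop. 5.6.2)

A proofs-only leaf (theorems only: no definition, no named fact; D-0026).  Let `g ∈ S_k(Γ₁(M))`,
`g ≠ 0`, lie in the `χ`-eigenspace of the diamond operators (`g ∈ S_k(M, χ)`) and be an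
eigenvector of the Hecke operators `T_p` for the primes `p ∤ M`, `T_p g = a_p g`.  Then there are
a divisor `M₀ ∣ M` and a **newform** `g₀ ∈ S_k(Γ₁(M₀))` (`IsNewform1`) with the same eigenvalue
packet away from `M`:

* `exists_isNewform1_of_eigenpacket` — `a_p(g₀) = a_p` for every prime `p ∤ M`, and `χ` is the
  character of level `M` induced by the nebentypus of `g₀`.

This is the classical consequence of Atkin–Lehner–Li theory by which "eigenform" may be replaced by
"newform" in every statement that only sees the `T_p`, `p ∤ M` — e.g. the Galois representations
attached to eigenforms: Deligne–Serre 1974, Thm. 6.1 is stated for `T_p`-eigenforms (`p ∤ N`),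
while Deligne 1971 / Ribet 1977, Thm. (2.1) / Diamond–Shurman, Thm. 9.6.5 are stated for
newforms.  Printed sources: Diamond–Shurman, *A first course in modular forms*, §5.8, proof of
Thm. 5.8.3 (PDF p. 219): `S_k(Γ₁(N)) = ⊕_{M ∣ N} ⊕_{d ∣ N/M} ι_d(S_k(Γ₁(M))^{new})`, each new
subspace spanned by newforms (Thm. 5.8.2), the maps `ι_d` commuting with `T_p`, `p ∤ N`, and with
the diamond operators (Prop. 5.6.2, Ex. 5.8.6 (a)); Li 1975, Thm. 3 and Cor. 3.

Proof (as printed, assembled from the tree).  Call `b ∈ S_k(Γ₁(M))` a *packet vector* if it is a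
simultaneous eigenvector of the `T_p` (`p ∤ M`) and the `⟨u⟩` with the eigenvalues `a_p(g₀)`,
`ε_{g₀}(u)` of some newform `g₀` of some level `M₀ ∣ M` (the predicate is spelled out in each
statement below).  (1) `span_packetVectors_eq_top` — by strong induction on the level,
`S_k(Γ₁(M))` is spanned by packet vectors: `S_k(Γ₁(M)) = old ⊕ new`
(`oldSubspace1_sup_newSubspace1_holds`, Li 1975, Thm. 3), `new` is spanned by newforms
(`span_newforms1_holds`, Diamond–Shurman Thm. 5.8.2), a newform is a packet vector for itself
(`T_p g₀ = a_p(g₀) g₀`, `IsNewform1.heckeEigenvalue_eq_coeff_holds`; `⟨u⟩ g₀ = ε(u) g₀`,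
`IsNewform1.mem_nebentypusSubspace_nebentypus_holds`), and `old` is the sum of the images of the
lower levels `M₁` under the degeneracy maps `[α_d]_k` (`M₁ d ∣ M`), which carry packet vectors to
packet vectors (`isPacketVector_degeneracyMap1`: `T_p [α_d] = [α_d] T_p` for `p ∤ M`,
`heckeT_degeneracyMap1_of_not_dvd`; `⟨u⟩_M [α_d] = [α_d] ⟨u mod M₁⟩_{M₁}`,
`diamondOp_degeneracyMap1`; Diamond–Shurman Prop. 5.6.2).  (2) The joint (generalised)
eigenspaces of the commuting family `{T_p : p ∤ M} ∪ {⟨u⟩}` (`heckeT_comm_holds`,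
`heckeT_diamondOp_comm_holds`, `diamondOp_comm`) for distinct eigenvalue packets are independent
(Mathlib `Module.End.independent_iInf_maxGenEigenspace_of_forall_mapsTo`); `g` lies in the joint
eigenspace of its own packet and in the span of the packet vectors, i.e. in the sum of the joint
eigenspaces of the newform packets; were its packet not among them, `g` would lie in the
intersection of its joint eigenspace with the sum of the others, which is zero.

## References

* F. Diamond, J. Shurman, *A first course in modular forms*, GTM 228, Springer 2005: Prop. 5.2.4,
  Prop. 5.6.2 (PDF pp. 209–210), Thm. 5.8.2 and Thm. 5.8.3 with its proof (PDF pp. 216–219),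
  Ex. 5.8.6 (a). [DiamondShurman2005]
* W.-C. W. Li, *Newforms and functional equations*, Math. Ann. 212 (1975), 285–315, Thm. 3 and
  Cor. 3. [Li1975]
* P. Deligne, J.-P. Serre, *Formes modulaires de poids 1*, Ann. Sci. ÉNS (4) 7 (1974), 507–530,
  Thm. 6.1 (p. 520). [DeligneSerreASENS1974]
-/

noncomputable section

open scoped MatrixGroups ModularForm

open CongruenceSubgroup

namespace Literature.NumberTheory.EllipticCurves.ModularForms

/-! ### Packet vectors -/

section Packet

variable {M : ℕ} [NeZero M] {k : ℤ}

/-- A newform is a packet vector for its own packet: `T_p g₀ = a_p(g₀) g₀` for `p ∤ M` and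
`⟨u⟩ g₀ = ε(u) g₀` (Diamond–Shurman Thm. 5.8.2 and §5.2). [cite: DiamondShurman2005, Thm. 5.8.2] -/
theorem IsNewform1.isPacketVector {g₀ : CuspForm (Gamma1 M) k} (hg₀ : IsNewform1 g₀) :
    ∃ (M₀ : ℕ) (_ : NeZero M₀) (hM₀ : M₀ ∣ M) (g₁ : CuspForm (Gamma1 M₀) k), IsNewform1 g₁ ∧
      (∀ (p : ℕ) (hp : p.Prime), ¬ p ∣ M →
        (haveI : NeZero p := ⟨hp.ne_zero⟩; heckeT (Gamma1 M) k p g₀) = cuspCoeff g₁ p • g₀) ∧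
      (∀ u : (ZMod M)ˣ, diamondOp M k (u : ZMod M) g₀ =
        DirichletCharacter.changeLevel hM₀ (nebentypus g₁) (u : ZMod M) • g₀) := by
  refine ⟨M, inferInstance, dvd_rfl, g₀, hg₀, fun p hp _ ↦ ?_, fun u ↦ ?_⟩
  · haveI : NeZero p := ⟨hp.ne_zero⟩
    have h := heckeT_eq_heckeEigenvalue_smul g₀ p (hg₀.2.1 p hp)
    rw [IsNewform1.heckeEigenvalue_eq_coeff_holds hg₀ hp] at h
    exact h
  · rw [DirichletCharacter.changeLevel_self]
    exact (mem_nebentypusSubspace_iff_diamondOp.mp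
      (IsNewform1.mem_nebentypusSubspace_nebentypus_holds hg₀)) u

/-- **Degeneracy maps carry packet vectors to packet vectors** (Diamond–Shurman Prop. 5.6.2:
`T_p [α_d]_k = [α_d]_k T_p` for `p ∤ M`, `⟨u⟩_M [α_d]_k = [α_d]_k ⟨u⟩_{M₁}`), for `M₁ d ∣ M`.
[cite: DiamondShurman2005, Prop. 5.6.2] -/
theorem isPacketVector_degeneracyMap1 {M₁ d : ℕ} [NeZero M₁] [NeZero d] (hMd : M₁ * d ∣ M)
    {b : CuspForm (Gamma1 M₁) k}
    (hb : ∃ (M₀ : ℕ) (_ : NeZero M₀) (hM₀ : M₀ ∣ M₁) (g₀ : CuspForm (Gamma1 M₀) k), IsNewform1 g₀ ∧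
      (∀ (p : ℕ) (hp : p.Prime), ¬ p ∣ M₁ →
        (haveI : NeZero p := ⟨hp.ne_zero⟩; heckeT (Gamma1 M₁) k p b) = cuspCoeff g₀ p • b) ∧
      (∀ u : (ZMod M₁)ˣ, diamondOp M₁ k (u : ZMod M₁) b =
        DirichletCharacter.changeLevel hM₀ (nebentypus g₀) (u : ZMod M₁) • b)) :
    ∃ (M₀ : ℕ) (_ : NeZero M₀) (hM₀ : M₀ ∣ M) (g₀ : CuspForm (Gamma1 M₀) k), IsNewform1 g₀ ∧
      (∀ (p : ℕ) (hp : p.Prime), ¬ p ∣ M →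
        (haveI : NeZero p := ⟨hp.ne_zero⟩; heckeT (Gamma1 M) k p (degeneracyMap1 M₁ M d k b)) =
          cuspCoeff g₀ p • degeneracyMap1 M₁ M d k b) ∧
      (∀ u : (ZMod M)ˣ, diamondOp M k (u : ZMod M) (degeneracyMap1 M₁ M d k b) =
        DirichletCharacter.changeLevel hM₀ (nebentypus g₀) (u : ZMod M) •
          degeneracyMap1 M₁ M d k b) := by
  obtain ⟨M₀, _, hM₀, g₀, hg₀, hT, hD⟩ := hb
  have hM₁M : M₁ ∣ M := (dvd_mul_right M₁ d).trans hMd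
  refine ⟨M₀, inferInstance, hM₀.trans hM₁M, g₀, hg₀, fun p hp hpM ↦ ?_, fun u ↦ ?_⟩
  · haveI : NeZero p := ⟨hp.ne_zero⟩
    have hpM₁ : ¬ p ∣ M₁ := fun h ↦ hpM (h.trans hM₁M)
    have hpd : ¬ p ∣ d := fun h ↦ hpM (h.trans ((dvd_mul_left d M₁).trans hMd))
    rw [heckeT_degeneracyMap1_of_not_dvd k hMd hp hpd ⟨fun h ↦ (hpM₁ h).elim, fun h ↦ (hpM h).elim⟩,
      hT p hp hpM₁, map_smul]
  · rw [diamondOp_degeneracyMap1 M k hMd u.isUnit b]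
    obtain ⟨u₁, hu₁⟩ := u.isUnit.map (ZMod.castHom hM₁M (ZMod M₁))
    rw [← hu₁, hD u₁, map_smul, DirichletCharacter.changeLevel_trans _ hM₀ hM₁M,
      DirichletCharacter.changeLevel_eq_cast_of_dvd _ hM₁M u, hu₁, ZMod.castHom_apply]

variable (k)

/-- `S_k(Γ₁(M))` is spanned by packet vectors — the statement of `span_packetVectors_eq_top`
with the level an explicit natural number, for the induction on the level. [cite: DiamondShurman2005, Thm. 5.8.3 (proof)] -/
theorem span_packetVectors_eq_top_aux :
    ∀ (M : ℕ) (hM : M ≠ 0), haveI : NeZero M := ⟨hM⟩;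
      Submodule.span ℂ {b : CuspForm (Gamma1 M) k |
        ∃ (M₀ : ℕ) (_ : NeZero M₀) (hM₀ : M₀ ∣ M) (g₀ : CuspForm (Gamma1 M₀) k), IsNewform1 g₀ ∧
          (∀ (p : ℕ) (hp : p.Prime), ¬ p ∣ M →
            (haveI : NeZero p := ⟨hp.ne_zero⟩; heckeT (Gamma1 M) k p b) = cuspCoeff g₀ p • b) ∧
          (∀ u : (ZMod M)ˣ, diamondOp M k (u : ZMod M) b =
            DirichletCharacter.changeLevel hM₀ (nebentypus g₀) (u : ZMod M) • b)} = ⊤ := by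
  intro M
  induction M using Nat.strong_induction_on with
  | _ M ih =>
  intro hM
  haveI : NeZero M := ⟨hM⟩
  apply top_unique
  rw [← oldSubspace1_sup_newSubspace1_holds M k, sup_le_iff]
  constructor
  · -- the old subspace: images of the lower levels
    rw [oldSubspace1, iSup_le_iff]
    rintro ⟨⟨M₁, d⟩, hM₁, hMd⟩
    haveI hM₁0 : NeZero M₁ := ⟨(Nat.pos_of_mem_properDivisors hM₁).ne'⟩
    haveI : NeZero d := ⟨fun h ↦ NeZero.ne M (Nat.eq_zero_of_zero_dvd (by simpa [h] using hMd))⟩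
    have hlt : M₁ < M := (Nat.mem_properDivisors.mp hM₁).2
    have ih₁ := ih M₁ hlt hM₁0.out
    dsimp only at hMd ih₁ ⊢
    rw [LinearMap.range_eq_map, ← ih₁, Submodule.map_span, Submodule.span_le]
    rintro _ ⟨b, hb, rfl⟩
    exact Submodule.subset_span (isPacketVector_degeneracyMap1 hMd hb)
  · -- the new subspace: spanned by newforms
    rw [← span_newforms1_holds M k, Submodule.span_le]
    intro g₀ hg₀
    exact Submodule.subset_span (IsNewform1.isPacketVector hg₀)

variable (M)

/-- **`S_k(Γ₁(M))` is spanned by packet vectors** (Diamond–Shurman, proof of Thm. 5.8.3: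
`S_k(Γ₁(N)) = Σ_{M ∣ N} Σ_{d} ι_d S_k(Γ₁(M))^{new}`, each new subspace spanned by newforms):
simultaneous eigenvectors of the `T_p`, `p ∤ M`, and the `⟨u⟩` carrying the eigenvalue packet of a
newform of some level `M₀ ∣ M` span `S_k(Γ₁(M))`.  By strong induction on the level from
`old ⊕ new = S_k(Γ₁(M))` and multiplicity one. [cite: DiamondShurman2005, Thm. 5.8.3 (proof)] -/
theorem span_packetVectors_eq_top :
    Submodule.span ℂ {b : CuspForm (Gamma1 M) k |
      ∃ (M₀ : ℕ) (_ : NeZero M₀) (hM₀ : M₀ ∣ M) (g₀ : CuspForm (Gamma1 M₀) k), IsNewform1 g₀ ∧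
        (∀ (p : ℕ) (hp : p.Prime), ¬ p ∣ M →
          (haveI : NeZero p := ⟨hp.ne_zero⟩; heckeT (Gamma1 M) k p b) = cuspCoeff g₀ p • b) ∧
        (∀ u : (ZMod M)ˣ, diamondOp M k (u : ZMod M) b =
          DirichletCharacter.changeLevel hM₀ (nebentypus g₀) (u : ZMod M) • b)} = ⊤ :=
  span_packetVectors_eq_top_aux k M (NeZero.ne M)

end Packet

/-! ### The theorem -/

section Main

variable {M : ℕ} [NeZero M] {k : ℤ}

set_option maxHeartbeats 400000 in
/-- **The eigenvalue packet of an eigenform is the packet of a newform of level dividing the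
level** (Atkin–Lehner–Li; Diamond–Shurman Thm. 5.8.2–5.8.3 with Prop. 5.6.2; Li 1975, Thm. 3 and
Cor. 3).  Let `g ∈ S_k(Γ₁(M))`, `g ≠ 0`, with `g ∈ S_k(M, χ)` and `T_p g = a_p g` for every prime
`p ∤ M`.  Then there are `M₀ ∣ M` and a newform `g₀ ∈ S_k(Γ₁(M₀))` with `a_p(g₀) = a_p` for every
prime `p ∤ M` and whose nebentypus induces `χ`. [cite: DiamondShurman2005, Thm. 5.8.2–5.8.3 and Prop. 5.6.2] -/
theorem exists_isNewform1_of_eigenpacket {g : CuspForm (Gamma1 M) k} (hg0 : g ≠ 0)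
    {χ : DirichletCharacter ℂ M} (hgχ : g ∈ nebentypusSubspace M k χ) {a : ℕ → ℂ}
    (hT : ∀ (p : ℕ) (hp : p.Prime), ¬ p ∣ M →
      (haveI : NeZero p := ⟨hp.ne_zero⟩; heckeT (Gamma1 M) k p g) = a p • g) :
    ∃ (M₀ : ℕ) (_ : NeZero M₀) (hM₀ : M₀ ∣ M) (g₀ : CuspForm (Gamma1 M₀) k), IsNewform1 g₀ ∧
      (∀ p : ℕ, p.Prime → ¬ p ∣ M → cuspCoeff g₀ p = a p) ∧
      DirichletCharacter.changeLevel hM₀ (nebentypus g₀) = χ := by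
  classical
  -- the commuting family `{T_p : p ∤ M} ∪ {⟨u⟩}`, indexed by `I`
  let I : Type := {p : ℕ // p.Prime ∧ ¬ p ∣ M} ⊕ (ZMod M)ˣ
  let F : I → Module.End ℂ (CuspForm (Gamma1 M) k) :=
    Sum.elim (fun p ↦ haveI : NeZero p.1 := ⟨p.2.1.ne_zero⟩; heckeT (Gamma1 M) k p.1)
      (fun u ↦ diamondOp M k (u : ZMod M))
  have hcomm : ∀ i j : I, Commute (F i) (F j) := by
    rintro (⟨p, hp, hpM⟩ | u) (⟨q, hq, hqM⟩ | v)
    · haveI : NeZero p := ⟨hp.ne_zero⟩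
      haveI : NeZero q := ⟨hq.ne_zero⟩
      exact heckeT_comm_holds M k p q
    · haveI : NeZero p := ⟨hp.ne_zero⟩
      exact heckeT_diamondOp_comm_holds (N := M) (k := k) p (v : ZMod M)
    · haveI : NeZero q := ⟨hq.ne_zero⟩
      exact (heckeT_diamondOp_comm_holds (N := M) (k := k) q (u : ZMod M)).symm
    · exact diamondOp_comm M k _ _
  -- its joint generalised eigenspaces `V θ`, `θ : I → ℂ` an eigenvalue packet, are independent
  let V : (I → ℂ) → Submodule ℂ (CuspForm (Gamma1 M) k) :=
    fun θ ↦ ⨅ i, (F i).maxGenEigenspace (θ i)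
  have hind : iSupIndep V :=
    Module.End.independent_iInf_maxGenEigenspace_of_forall_mapsTo F fun i j φ ↦
      Module.End.mapsTo_maxGenEigenspace_of_comm (hcomm j i) φ
  -- packets: of `(a, χ)` and of a newform `g₀` of level `M₀ ∣ M`
  let pk : (ℕ → ℂ) → DirichletCharacter ℂ M → I → ℂ :=
    fun a' χ' ↦ Sum.elim (fun p ↦ a' p.1) (fun u ↦ χ' (u : ZMod M))
  have hmemV : ∀ {b : CuspForm (Gamma1 M) k} {a' : ℕ → ℂ} {χ' : DirichletCharacter ℂ M},
      (∀ (p : ℕ) (hp : p.Prime), ¬ p ∣ M →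
        (haveI : NeZero p := ⟨hp.ne_zero⟩; heckeT (Gamma1 M) k p b) = a' p • b) →
      (∀ u : (ZMod M)ˣ, diamondOp M k (u : ZMod M) b = χ' (u : ZMod M) • b) →
      b ∈ V (pk a' χ') := by
    intro b a' χ' hT' hD'
    change b ∈ ⨅ i, (F i).maxGenEigenspace (pk a' χ' i)
    rw [Submodule.mem_iInf]
    rintro (⟨p, hp, hpM⟩ | u)
    · exact Module.End.eigenspace_le_maxGenEigenspace
        (Module.End.mem_eigenspace_iff.mpr (hT' p hp hpM))
    · exact Module.End.eigenspace_le_maxGenEigenspace (Module.End.mem_eigenspace_iff.mpr (hD' u))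
  -- `g` lies in the joint eigenspace of its packet
  have hgV : g ∈ V (pk a χ) := hmemV hT (mem_nebentypusSubspace_iff_diamondOp.mp hgχ)
  -- the newform packets
  let Θ : Set (I → ℂ) :=
    {θ | ∃ (M₀ : ℕ) (_ : NeZero M₀) (hM₀ : M₀ ∣ M) (g₀ : CuspForm (Gamma1 M₀) k),
      IsNewform1 g₀ ∧ θ = pk (cuspCoeff g₀) (DirichletCharacter.changeLevel hM₀ (nebentypus g₀))}
  -- every packet vector lies in the joint eigenspace of a newform packet, so these span
  have hspan : (⊤ : Submodule ℂ (CuspForm (Gamma1 M) k)) ≤ ⨆ θ ∈ Θ, V θ := by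
    rw [← span_packetVectors_eq_top M k, Submodule.span_le]
    rintro b ⟨M₀, _, hM₀, g₀, hg₀, hbT, hbD⟩
    have hθ : pk (cuspCoeff g₀) (DirichletCharacter.changeLevel hM₀ (nebentypus g₀)) ∈ Θ :=
      ⟨M₀, inferInstance, hM₀, g₀, hg₀, rfl⟩
    exact (le_biSup V hθ) (hmemV hbT hbD)
  -- hence the packet of `g` is a newform packet
  have hmem : pk a χ ∈ Θ := by
    by_contra hnot
    have hdis : Disjoint (V (pk a χ)) (⨆ θ ∈ Θ, V θ) := hind.disjoint_biSup hnot
    exact hg0 ((Submodule.disjoint_def.mp hdis) g hgV (hspan Submodule.mem_top))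
  obtain ⟨M₀, _, hM₀, g₀, hg₀, hθ⟩ := hmem
  refine ⟨M₀, inferInstance, hM₀, g₀, hg₀, fun p hp hpM ↦ ?_, ?_⟩
  · have h := congrFun hθ (.inl ⟨p, hp, hpM⟩)
    simp only [pk, Sum.elim_inl] at h
    exact h.symm
  · refine MulChar.ext fun u ↦ ?_
    have h := congrFun hθ (.inr u)
    simp only [pk, Sum.elim_inr] at h
    exact h.symm

end Main

end Literature.NumberTheory.EllipticCurves.ModularForms

end
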